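import Mathlib.Algebra.CharP.Lemmas
import Mathlib.FieldTheory.IsAlgClosed.Basic
import Summits.ABC.IUTFork.Joshi.ArithHolStructureTiltComplete
import HarnessLib

/-!
# Towards `IsAlgClosed (K♭)`: Teichmüller towers of coefficients, level polynomials over `𝒪_K`, and ROOT MATCHING between levels
# (MODEL / SUPPLY over p442777/p446090/p447287; part 1 of 2)

Block E (rung LADDER-ABC:A2.E), seat abc-iut-E-t10 (gen 4). [J-I] = Joshi, arXiv:2106.11452v4, §3.3 p.9 l.31–33 «K♭, algebraically closed,
perfectoid of characteristic p»; Def. 4.1.1 (1) p.18 l.11ff types the tilt base with `[IsAlgClosed F]` — the ONE slot at `F := K♭` left open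
by p431050 (f) / p447287. This file and `ArithHolStructureTiltAlgClosed.lean` prove it by an ELEMENTARY, limit-free argument
(blueprint `HOME/staging/E/t10/PLAN-IsAlgClosedTilt.md`): for a monic `P(Y) = Y^d + Σ a_i Y^i` over `𝒪_{K♭} = (𝒪_K/p)^perf`,
* `towerInt a n ∈ 𝒪_K` = the `n`-th Teichmüller coordinate `a^{♯,1/pⁿ}` (`(towerInt a (n+1))^p = towerInt a n` EXACTLY; `a_n = towerInt a n mod p`);
* the LEVEL POLYNOMIALS `levelPoly n = Y^d + Σ (towerInt a_i n) Y^i ∈ 𝒪_K[Y]`: monic, so (K algebraically closed) with roots, all in `𝒪_K`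
  (`norm_root_le_one`), and `levelPoly n (y) = Π_roots (y − b)` in `K`;
* the two norm estimates on `𝒪_K`: `‖x^k − y^k‖ ≤ ‖x − y‖` and the DECAY `‖x^p − y^p‖ ≤ ‖x − y‖·max(‖x − y‖, ‖p‖)` (`exists_add_pow_prime_eq`),
  iterated: `‖x − y‖^{p·d} ≤ ‖p‖ ⟹ x^{p^{p·d}} ≡ y^{p^{p·d}} (mod p)`;
* **UPWARD ROOT MATCHING** `exists_root_succ`: every root `β` of `levelPoly n` has a root `β′` of `levelPoly (n+1)` with
  `‖β − β′^p‖^{p·d} ≤ ‖p‖` — freshman's dream in `𝒪_K/p` gives `(levelPoly (n+1) (β^{1/p}))^p ≡ levelPoly n (β) = 0`, the product over the `d`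
  roots then puts one root `b₀` within `‖β^{1/p} − b₀‖^{pd} ≤ ‖p‖`, and `‖β − b₀^p‖ ≤ ‖β^{1/p} − b₀‖`.
All [folklore] (cf. [Scholze 2012, Prop. 3.8]); no claim of Joshi's used or asserted; no `Prop` hypothesis, instance, notation or FACT-LIST row.
No side taken on [IUTchIII] Cor. 3.12 or on any author. bears_on: LADDER-ABC:A2.E.
-/

noncomputable section

open scoped NNReal
open Polynomial

namespace Summit.ABC.IUTFork.Joshi.ATS1

open Summit.ABC.IUTFork.Joshi

variable {p : ℕ} [Fact p.Prime]

namespace TiltModel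

/-! ## 1. Norm estimates in `𝒪_K` -/

/-- `‖x^k − y^k‖ ≤ ‖x − y‖` for `x, y ∈ 𝒪_K` (`x − y ∣ x^k − y^k` with an integral cofactor). [folklore] -/
theorem norm_pow_sub_pow_le {U : Untilt p} (x y : int U) (k : ℕ) :
    ‖(x : U.K) ^ k - (y : U.K) ^ k‖ ≤ ‖(x : U.K) - y‖ := by
  obtain ⟨w, hw⟩ := sub_dvd_pow_sub_pow x y k
  have h : (x : U.K) ^ k - (y : U.K) ^ k = ((x : U.K) - y) * w := by
    have := congrArg ((↑) : int U → U.K) hw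
    push_cast at this
    exact this
  rw [h, norm_mul]
  exact mul_le_of_le_one_right (norm_nonneg _) (norm_coe_le_one w)

/-- **Decay**: `‖x^p − y^p‖ ≤ ‖x − y‖ · max ‖x − y‖ ‖p‖` for `x, y ∈ 𝒪_K` (`x^p − y^p = (x−y)^p + p·y·(x−y)·r`). [folklore] -/
theorem norm_pow_p_sub_pow_p_le {U : Untilt p} (x y : int U) :
    ‖(x : U.K) ^ p - (y : U.K) ^ p‖ ≤ ‖(x : U.K) - y‖ * max ‖(x : U.K) - y‖ ‖(p : U.K)‖ := by
  have hp : p.Prime := Fact.out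
  obtain ⟨r, hr⟩ := exists_add_pow_prime_eq hp y (x - y)
  rw [add_sub_cancel] at hr
  have hpow : (x - y) ^ p = (x - y) * (x - y) ^ (p - 1) := by
    rw [← pow_succ']; congr 1; exact (Nat.sub_add_cancel hp.one_le).symm
  have h : x ^ p - y ^ p = (x - y) * ((x - y) ^ (p - 1) + (p : int U) * y * r) := by
    rw [mul_add, ← hpow]; linear_combination hr
  have hK : (x : U.K) ^ p - (y : U.K) ^ p = ((x : U.K) - y) * (((x : U.K) - y) ^ (p - 1) + (p : U.K) * y * r) := by
    have := congrArg ((↑) : int U → U.K) h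
    push_cast at this
    exact this
  have hxy : ‖(x : U.K) - y‖ ≤ 1 := by
    have := norm_coe_le_one (x - y); push_cast at this; exact this
  rw [hK, norm_mul]
  refine mul_le_mul_of_nonneg_left ((IsUltrametricDist.norm_add_le_max _ _).trans (max_le_max ?_ ?_)) (norm_nonneg _)
  · rw [norm_pow]
    exact pow_le_of_le_one (norm_nonneg _) hxy (Nat.sub_ne_zero_of_lt hp.one_lt)
  · rw [norm_mul, norm_mul]
    calc ‖(p : U.K)‖ * ‖(y : U.K)‖ * ‖(r : U.K)‖ ≤ ‖(p : U.K)‖ * 1 * 1 := by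
          gcongr <;> exact norm_coe_le_one _
      _ = ‖(p : U.K)‖ := by rw [mul_one, mul_one]

/-- **Iterated decay**: `‖x^{p^k} − y^{p^k}‖ ≤ max ‖p‖ (‖x − y‖^{k+1})`. [folklore] -/
theorem norm_iterate_sub_le {U : Untilt p} (x y : int U) (k : ℕ) :
    ‖(x : U.K) ^ p ^ k - (y : U.K) ^ p ^ k‖ ≤ max ‖(p : U.K)‖ (‖(x : U.K) - y‖ ^ (k + 1)) := by
  have hxy : ‖(x : U.K) - y‖ ≤ 1 := by
    have := norm_coe_le_one (x - y); push_cast at this; exact this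
  have hp1 : ‖(p : U.K)‖ ≤ 1 := U.norm_p_lt_one.le
  induction k with
  | zero => rw [pow_zero, pow_one, pow_one, zero_add, pow_one]; exact le_max_right _ _
  | succ k ih =>
    have step := norm_pow_p_sub_pow_p_le (x ^ p ^ k) (y ^ p ^ k)
    push_cast at step
    rw [← pow_mul, ← pow_mul, ← pow_succ] at step
    set e := ‖(x : U.K) ^ p ^ k - (y : U.K) ^ p ^ k‖ with he
    have he0 : 0 ≤ e := norm_nonneg _
    have he1 : e ≤ 1 := by
      have := norm_coe_le_one (x ^ p ^ k - y ^ p ^ k); push_cast at this; exact this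
    refine step.trans ?_
    rcases le_or_gt e ‖(p : U.K)‖ with h | h
    · calc e * max e ‖(p : U.K)‖ ≤ e * 1 := mul_le_mul_of_nonneg_left (max_le he1 hp1) he0
        _ ≤ _ := by rw [mul_one]; exact h.trans (le_max_left _ _)
    · have hek : e ≤ ‖(x : U.K) - y‖ ^ (k + 1) := (le_max_iff.1 ih).resolve_left (not_le.2 h)
      rw [max_eq_left h.le]
      calc e * e ≤ ‖(x : U.K) - y‖ ^ (k + 1) * ‖(x : U.K) - y‖ ^ (k + 1) := mul_le_mul hek hek he0 (he0.trans hek)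
        _ = ‖(x : U.K) - y‖ ^ (2 * k + 2) := by rw [← pow_add]; ring_nf
        _ ≤ ‖(x : U.K) - y‖ ^ (k + 1 + 1) := pow_le_pow_of_le_one (norm_nonneg _) hxy (by omega)
        _ ≤ _ := le_max_right _ _

/-- **`‖x − y‖^{p·d} ≤ ‖p‖ ⟹ x^{p^{p·d}} ≡ y^{p^{p·d}} (mod p)`** in `𝒪_K`. [folklore] -/
theorem pow_sub_pow_mem_span_p {U : Untilt p} (x y : int U) {d : ℕ} (h : ‖(x : U.K) - y‖ ^ (p * d) ≤ ‖(p : U.K)‖) :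
    x ^ p ^ (p * d) - y ^ p ^ (p * d) ∈ Ideal.span {((p : ℕ) : int U)} := by
  have hxy : ‖(x : U.K) - y‖ ≤ 1 := by
    have := norm_coe_le_one (x - y); push_cast at this; exact this
  rw [mem_span_p_iff]
  push_cast
  refine (norm_iterate_sub_le x y (p * d)).trans (max_le le_rfl (le_trans ?_ h))
  exact pow_le_pow_of_le_one (norm_nonneg _) hxy (Nat.le_succ _)

/-- Ultrametric closure of «`‖z‖^N ≤ c`» under sums. [folklore] -/
theorem pow_norm_add_le {U : Untilt p} {z₁ z₂ : U.K} {N : ℕ} {c : ℝ} (h₁ : ‖z₁‖ ^ N ≤ c) (h₂ : ‖z₂‖ ^ N ≤ c) :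
    ‖z₁ + z₂‖ ^ N ≤ c := by
  refine (pow_le_pow_left₀ (norm_nonneg _) (IsUltrametricDist.norm_add_le_max z₁ z₂) N).trans ?_
  rcases le_total ‖z₁‖ ‖z₂‖ with h | h
  · rw [max_eq_right h]; exact h₂
  · rw [max_eq_left h]; exact h₁

/-- … and under `‖z′‖ ≤ ‖z‖`. [folklore] -/
theorem pow_norm_le_of_norm_le {U : Untilt p} {z z' : U.K} {N : ℕ} {c : ℝ} (hz : ‖z'‖ ≤ ‖z‖) (h : ‖z‖ ^ N ≤ c) :
    ‖z'‖ ^ N ≤ c :=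
  (pow_le_pow_left₀ (norm_nonneg _) hz N).trans h

/-- `‖Π s‖₊ = Π ‖·‖₊` over a multiset (normed field). [folklore] -/
theorem nnnorm_multiset_prod {U : Untilt p} (s : Multiset U.K) : ‖s.prod‖₊ = (s.map fun x => ‖x‖₊).prod := by
  induction s using Multiset.induction_on with
  | empty => simp
  | cons a s ih => simp [ih]

/-- A root in `K` of a MONIC polynomial with coefficients in `𝒪_K` lies in `𝒪_K` (ultrametric). [folklore] -/
theorem norm_root_le_one {U : Untilt p} (q : (int U)[X]) (hq : q.Monic) (b : U.K) (hb : (q.map (int U).subtype).eval b = 0) :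
    ‖b‖ ≤ 1 := by
  by_contra hb1
  rw [not_le] at hb1
  set N := q.natDegree with hN
  have hb0 : 0 < ‖b‖ := one_pos.trans hb1
  rw [eval_eq_sum_range, hq.natDegree_map, Finset.sum_range_succ, coeff_map, ← hN,
    show q.coeff N = 1 from hq, map_one, one_mul] at hb
  -- `b^N = -Σ_{i<N} q_i b^i`
  have hsum : ‖b ^ N‖ ≤ ‖b‖ ^ N * ‖b‖⁻¹ := by
    rw [show b ^ N = -∑ i ∈ Finset.range N, (q.map (int U).subtype).coeff i * b ^ i from eq_neg_of_add_eq_zero_right hb,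
      norm_neg]
    refine IsUltrametricDist.norm_sum_le_of_forall_le_of_nonneg (by positivity) fun i hi => ?_
    rw [Finset.mem_range] at hi
    rw [coeff_map, norm_mul, norm_pow]
    calc ‖((int U).subtype (q.coeff i))‖ * ‖b‖ ^ i ≤ 1 * ‖b‖ ^ (N - 1) := by
          refine mul_le_mul (norm_coe_le_one _) (pow_le_pow_right₀ hb1.le (by omega)) (by positivity) zero_le_one
      _ = ‖b‖ ^ N * ‖b‖⁻¹ := by
          rw [one_mul, pow_sub₀ _ hb0.ne' (show 1 ≤ N by omega), pow_one]
  rw [norm_pow] at hsum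
  have : ‖b‖ ^ N * 1 ≤ ‖b‖ ^ N * ‖b‖⁻¹ := by rwa [mul_one]
  have h1 : (1 : ℝ) ≤ ‖b‖⁻¹ := le_of_mul_le_mul_left this (pow_pos hb0 N)
  exact absurd (inv_lt_one_of_one_lt₀ hb1) (not_lt.2 h1)

/-! ## 2. Teichmüller towers of the coefficients and the level polynomials -/

section Integral

variable (U : Untilt p) [Fact (¬ IsUnit ((p : ℕ) : int U))] [IsAdicComplete (Ideal.span {((p : ℕ) : int U)}) (int U)]

/-- The `n`-th Teichmüller coordinate `a^{♯, 1/pⁿ} ∈ 𝒪_K` of `a ∈ 𝒪_{K♭}` (the `n`-th entry of p442777's `flatInt a`, kept in `𝒪_K`). [folklore] -/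
def towerInt (a : PreTilt (int U) p) (n : ℕ) : int U :=
  Perfection.coeffMonoidHom (int U) p n ((Perfection.quotientMulEquiv p (Ideal.span {((p : ℕ) : int U)})).symm a)

/-- `towerInt a n = (flatInt a)_n` in `K`. [folklore] -/
theorem coe_towerInt (a : PreTilt (int U) p) (n : ℕ) : (towerInt U a n : U.K) = flatInt U a n := rfl

/-- EXACT compatibility `(a^{♯,1/p^{n+1}})^p = a^{♯,1/pⁿ}` in `𝒪_K`. [folklore] -/
theorem towerInt_succ_pow (a : PreTilt (int U) p) (n : ℕ) : towerInt U a (n + 1) ^ p = towerInt U a n :=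
  Perfection.coeffMonoidHom_pow_p' _ n

/-- `a_n = a^{♯,1/pⁿ} mod p`: the `n`-th coefficient of `a ∈ (𝒪_K/p)^perf` is its `n`-th Teichmüller coordinate reduced mod `p`. [folklore] -/
theorem coeff_eq_mk_towerInt (a : PreTilt (int U) p) (n : ℕ) :
    PreTilt.coeff n a = Ideal.Quotient.mk _ (towerInt U a n) := by
  conv_lhs => rw [← (Perfection.quotientMulEquiv p (Ideal.span {((p : ℕ) : int U)})).apply_symm_apply a]
  rw [PreTilt.coeff_def, Perfection.coeff_quotientMulEquiv]
  rfl

variable {d : ℕ} (a : Fin d → PreTilt (int U) p)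

/-- **The level-`n` polynomial** `Y^d + Σ_i (a_i)^{♯,1/pⁿ} Y^i ∈ 𝒪_K[Y]` of the monic `Y^d + Σ a_i Y^i ∈ 𝒪_{K♭}[Y]`. [folklore] -/
def levelPoly (n : ℕ) : (int U)[X] := X ^ d + ∑ i : Fin d, C (towerInt U (a i) n) * X ^ (i : ℕ)

/-- `levelPoly n` evaluated. [folklore] -/
theorem levelPoly_eval (n : ℕ) (z : int U) :
    (levelPoly U a n).eval z = z ^ d + ∑ i : Fin d, towerInt U (a i) n * z ^ (i : ℕ) := by
  simp only [levelPoly, eval_add, eval_pow, eval_X, eval_finsetSum, eval_mul, eval_C]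

/-- `levelPoly n` is monic of degree `d`. [folklore] -/
theorem levelPoly_monic (n : ℕ) : (levelPoly U a n).Monic := monic_X_pow_add (degree_sum_fin_lt _)

/-- `natDegree (levelPoly n) = d`. [folklore] -/
theorem levelPoly_natDegree (n : ℕ) : (levelPoly U a n).natDegree = d := by
  by_cases hU : Nontrivial (int U)
  · rw [levelPoly, natDegree_add_eq_left_of_degree_lt, natDegree_X_pow]
    rw [degree_X_pow]; exact degree_sum_fin_lt _
  · rw [not_nontrivial_iff_subsingleton] at hU
    exact absurd hU (not_subsingleton (int U))

/-- **FRESHMAN'S DREAM between levels**: `(levelPoly (n+1) (z))^p ≡ levelPoly n (z^p) (mod p)` for `z ∈ 𝒪_K` (Frobenius of `𝒪_K/p`,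
exact tower compatibility of the coefficients). [folklore] -/
theorem levelPoly_succ_pow_modP (n : ℕ) (z : int U) :
    Ideal.Quotient.mk (Ideal.span {((p : ℕ) : int U)}) ((levelPoly U a (n + 1)).eval z ^ p) =
      Ideal.Quotient.mk (Ideal.span {((p : ℕ) : int U)}) ((levelPoly U a n).eval (z ^ p)) := by
  simp only [levelPoly_eval, map_pow, map_add, map_sum, map_mul, ← towerInt_succ_pow U _ n]
  rw [add_pow_char, sum_pow_char, ← pow_mul, ← pow_mul, mul_comm d p]
  congr 1
  refine Finset.sum_congr rfl fun i _ => ?_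
  rw [mul_pow, ← pow_mul, ← pow_mul, mul_comm (i : ℕ) p]

/-- Roots of a level polynomial in `K` lie in `𝒪_K` and are roots in `𝒪_K`. [folklore] -/
theorem exists_int_of_root (n : ℕ) (b : U.K) (hb : ((levelPoly U a n).map (int U).subtype).eval b = 0) :
    ∃ β : int U, (β : U.K) = b ∧ (levelPoly U a n).eval β = 0 := by
  have hb1 : b ∈ int U := (mem_int_iff U).2 (norm_root_le_one _ (levelPoly_monic U a n) b hb)
  refine ⟨⟨b, hb1⟩, rfl, ?_⟩
  apply Subtype.coe_injective
  show (int U).subtype ((levelPoly U a n).eval ⟨b, hb1⟩) = ((0 : int U) : U.K)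
  rw [← eval₂_at_apply, ← eval_map, ZeroMemClass.coe_zero]
  exact hb

/-- **Every level polynomial has a root in `𝒪_K`** (`K` algebraically closed; `d ≥ 1`). [folklore] -/
theorem exists_root_levelPoly (hd : 0 < d) (n : ℕ) : ∃ β : int U, (levelPoly U a n).eval β = 0 := by
  have hq : ((levelPoly U a n).map (int U).subtype).degree ≠ 0 := by
    rw [degree_eq_natDegree ((levelPoly_monic U a n).map _).ne_zero, (levelPoly_monic U a n).natDegree_map, levelPoly_natDegree]
    exact_mod_cast hd.ne'
  obtain ⟨b, hb⟩ := IsAlgClosed.exists_root _ hq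
  obtain ⟨β, -, hβ⟩ := exists_int_of_root U a n b hb
  exact ⟨β, hβ⟩

/-- **UPWARD ROOT MATCHING**: a root `β ∈ 𝒪_K` of `levelPoly n` has a root `β′ ∈ 𝒪_K` of `levelPoly (n+1)` with `‖β − β′^p‖^{p·d} ≤ ‖p‖`.
PROVED: `y := β^{1/p}`; `‖levelPoly (n+1) (y)‖^p ≤ ‖p‖` (freshman's dream); `levelPoly (n+1) (y) = Π_{roots b} (y − b)` over `d` roots, so the
nearest root `b₀` has `‖y − b₀‖^d ≤ ‖levelPoly (n+1) (y)‖`; and `‖β − b₀^p‖ = ‖y^p − b₀^p‖ ≤ ‖y − b₀‖`. [folklore] -/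
theorem exists_root_succ (hd : 0 < d) (n : ℕ) (β : int U) (hβ : (levelPoly U a n).eval β = 0) :
    ∃ β' : int U, (levelPoly U a (n + 1)).eval β' = 0 ∧ ‖(β : U.K) - (β' : U.K) ^ p‖ ^ (p * d) ≤ ‖(p : U.K)‖ := by
  classical
  have hp : p.Prime := Fact.out
  -- a `p`-th root `y` of `β`, integral
  obtain ⟨y, hy⟩ := IsAlgClosed.exists_pow_nat_eq (β : U.K) hp.pos
  have hy1 : ‖y‖ ≤ 1 := by
    have h := norm_coe_le_one β
    rw [← hy, norm_pow] at h
    exact (pow_le_one_iff_of_nonneg (norm_nonneg _) hp.ne_zero).1 h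
  set y' : int U := ⟨y, (mem_int_iff U).2 hy1⟩ with hy'
  have hy'p : y' ^ p = β := Subtype.ext (by rw [SubmonoidClass.coe_pow]; exact hy)
  -- freshman's dream: `‖levelPoly (n+1) (y)‖^p ≤ ‖p‖`
  set E : int U := (levelPoly U a (n + 1)).eval y' with hE
  have hEp : ‖(E : U.K)‖ ^ p ≤ ‖(p : U.K)‖ := by
    have hmem : E ^ p ∈ Ideal.span {((p : ℕ) : int U)} := by
      rw [← Ideal.Quotient.eq_zero_iff_mem, levelPoly_succ_pow_modP, hy'p, hβ, map_zero]
    have := (mem_span_p_iff U).1 hmem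
    rwa [SubmonoidClass.coe_pow, norm_pow] at this
  -- `levelPoly (n+1)` over `K`: monic, split, product over its `d` roots
  set q : (U.K)[X] := (levelPoly U a (n + 1)).map (int U).subtype with hq
  have hqm : q.Monic := (levelPoly_monic U a (n + 1)).map _
  have hqs : q.Splits := IsAlgClosed.splits q
  have hqd : q.roots.card = d := by
    rw [← hqs.natDegree_eq_card_roots, hq, (levelPoly_monic U a (n + 1)).natDegree_map, levelPoly_natDegree]
  have hqnd : q.natDegree = d := by rw [hq, (levelPoly_monic U a (n + 1)).natDegree_map, levelPoly_natDegree]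
  have hqd : q.roots.card = d := by rw [← hqs.natDegree_eq_card_roots, hqnd]
  have hqE : q.eval y = (E : U.K) := by
    show ((levelPoly U a (n + 1)).map (int U).subtype).eval ((int U).subtype y') = (int U).subtype E
    rw [eval_map, eval₂_at_apply]
  -- the nearest root `b₀`
  have hne : q.roots.toFinset.Nonempty :=
    Multiset.toFinset_nonempty.2 (hqs.roots_ne_zero (by rw [hqnd]; exact hd.ne'))
  obtain ⟨b₀, hb₀, hmin⟩ := Finset.exists_min_image q.roots.toFinset (fun b => ‖y - b‖₊) hne
  rw [Multiset.mem_toFinset] at hb₀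
  have hprod : ‖y - b₀‖₊ ^ d ≤ ‖(E : U.K)‖₊ := by
    have h1 := Multiset.pow_card_le_prod (s := q.roots.map fun b => ‖y - b‖₊) (a := ‖y - b₀‖₊) (fun x hx => by
      obtain ⟨b, hb, rfl⟩ := Multiset.mem_map.1 hx
      exact hmin b (Multiset.mem_toFinset.2 hb))
    rw [Multiset.card_map, hqd] at h1
    refine h1.trans_eq ?_
    rw [← hqE, hqs.eval_eq_prod_roots_of_monic hqm, nnnorm_multiset_prod, Multiset.map_map]
    rfl
  have h3 : ‖y - b₀‖ ^ (p * d) ≤ ‖(p : U.K)‖ := by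
    rw [mul_comm, pow_mul]
    have h' : ‖y - b₀‖ ^ d ≤ ‖(E : U.K)‖ := by exact_mod_cast hprod
    exact (pow_le_pow_left₀ (by positivity) h' p).trans hEp
  -- `b₀` is an integral root of `levelPoly (n+1)`
  have hb₀r : q.eval b₀ = 0 := ((mem_roots hqm.ne_zero).1 hb₀).eq_zero
  obtain ⟨β', hβ'b, hβ'⟩ := exists_int_of_root U a (n + 1) b₀ hb₀r
  refine ⟨β', hβ', pow_norm_le_of_norm_le ?_ h3⟩
  rw [← hy, ← hβ'b]
  exact norm_pow_sub_pow_le y' β' p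

end Integral

end TiltModel

end Summit.ABC.IUTFork.Joshi.ATS1

end
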